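import Literature.NumberTheory.Rogawski1990.FinExplicitTransferFactorConjRight
import Literature.NumberTheory.Rogawski1990.FinExplicitTransferFactorNondegenerate
import HarnessLib

/-!
# `κ_v(γ_H, γ′)` reads on ANY `u`-eigenvector of `γ′`: the norm test of Rogawski's explicit finite transfer factor without `Fin.find`
# (topic T6, #72 side; serves nodes N3 (κ) ∕ N4 ∕ N5 of `F0/P3a/T6b-TREE.md` §9)

Topic `NumberTheory/Rogawski1990`; namespace `Literature.NumberTheory.Rogawski1990`.  THEOREMS ONLY (no `def`, no named fact, no `sorry`, no
instance, no notation); imports ★ `FinExplicitTransferFactorConjRight` (F0P3a-p01, N1f-r: rank one on matching pairs, the relative position of a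
rank-one `P_v`) and ★ `FinExplicitTransferFactorNondegenerate` (B-p12, N2f: `χ_g(u)` expanded and a unit on `G`-regular pairs), nothing else of the
tree.  Cell `pub/hodgecm-mathlib`, F0∕P3a, seat F0P3a-p01 (g7).  HONEST LABEL: HC_CM is proved only modulo the printed citations («named inputs
remaining 2») until rung 0 closes; this file proves nothing of them.

WHY.  ★ `finKappaAt L v H′ γ_H γ′` (the sign `κ_v(γ_H, γ′) = κ(inv(ι_v(γ_H), γ′))` of print's `Φ^κ`, [Rogawski1990 §4.3 p. 43, §4.9 p. 55, §14.6
p. 242]) is DEFINED through the first non-zero column of `P_v = χ_g(γ′)` (★ `finRelPos`, a `Fin.find`) — a definition convenient for typing, awkward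
for its three consumers: the a.e.-triviality N3 (A-p16: an INTEGRAL generator `f_u` of the `u`-eigenline of an adelic component `γ̄_v`), the product
formula N4 and (4.3.3) N5 (F0P3a-p05∕p04∕p08: the GLOBAL eigenvector `c e₂` of a rational pair).  This file proves that on a matching pair the test may
be run on ANY non-zero `u`-eigenvector `p′` of `γ′` («`inv(γ_H, γ′)` at the degree-one factor is the class of `H′(p′, p′)` modulo norms for any
`u`-eigenvector `p′`», [Rogawski1990 §3.5 Prop. 3.5.2 (c) p. 29; LanglandsShelstad1987 §1]):
* §1 for `P_v = p qᵀ` (★ `finEigenlineProjector_eq_vecMulVec_of_isLocalNormPair`): `P_v r = (q·r) p` (every vector in the image is a multiple of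
  `p`); `γ′ · P_v = u · P_v` — the columns of `P_v` ARE `u`-eigenvectors (so on a `G`-regular matching pair a non-zero column is available without
  choosing a conjugator); for a `u`-eigenvector `p′` of `γ′` (`γ′ p′ = u p′`, `u = γ₂`): `P_v p′ = χ_g(u) p′` (`P_v` is the polynomial `χ_g` in `γ′`); hence when `χ_g(u)` is
  a unit (★ `isUnit_eval_finCharpolyTwo_of_isLocalGRegular`: `G`-regular pairs) `p′ = χ_g(u)⁻¹ (q·p′) · p` — the `u`-eigenline IS the line of `p`, with
  no dimension count and over the ring `E_v = ∏_{w∣v} L_w` (split places included);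
* §2 `x₀(λ p) = λ σ(λ) x₀(p)` for `x₀(p) = Σ_{i,k} σ(p_i) (H′_v)_{ik} p_k`, and the unit norm test ignores unit factors `λ σ(λ)`;
* §3 THE READING: at a NON-SPLIT `v`, on a matching pair with `χ_g(u)` a unit, for ANY non-zero `u`-eigenvector `p′` of `γ′`,
  **`finKappaAt L v H′ γ_H γ′ = if (∃ z, IsUnit z ∧ x₀(p′) = z σ(z)) then 1 else −1`** (`finKappaAt_eq_ite_of_eigenvector`), and the two corollaries
  `finKappaAt_eq_one_of_eigenvector_of_exists` ∕ `finKappaAt_eq_neg_one_of_eigenvector_of_not_exists`; at a split `v` ★ `finKappaAt_of_not_subsingleton`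
  already gives `+1` (restated on the same hypotheses as `finKappaAt_eq_one_of_eigenvector_of_not_subsingleton` for uniform consumption).

## References
* [Rogawski1990] J. D. Rogawski, *Automorphic Representations of Unitary Groups in Three Variables*, Ann. of Math. Stud. 123 (1990): §3.5 Prop. 3.5.2 (c)
  p. 29 (`H¹(F, T) = Π F_i^× ∕ N E_i^×` on the τ-stable factors; the degree-one factor), §4.3 p. 43 (`Φ^κ`, `κ(inv(γ, γ′))`), §4.9 p. 55 (`Δ_{G∕H}`),
  §14.6 p. 242 («`κ(γ, ψ_v(i(γ)))` is equal to `±1` and it is `+1` for almost all `v`»).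
* [LanglandsShelstad1987] R. P. Langlands, D. Shelstad, *On the definition of transfer factors*, Math. Ann. 278 (1987), §1 (`inv(γ_H, γ_G)`), §2.
-/

set_option autoImplicit false

noncomputable section

open NumberField IsDedekindDomain Matrix Polynomial
open Literature.NumberTheory.GaloisRepresentations
open scoped MatrixGroups

namespace Literature.NumberTheory.Rogawski1990

open Literature.NumberTheory.Automorphic

/-! ## §0 Two generic identities over a commutative ring with a ring endomorphism `σ` -/

section Generic

variable {R : Type*} [CommRing R]

/-- `x₀(λ p) = λ σ(λ) x₀(p)` for the `σ`-hermitian value `x₀(p) = Σ_{i,k} σ(p_i) H_{ik} p_k`. [folklore] -/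
private theorem sum_sum_map_smul_mul_mul_smul {n : Type*} [Fintype n] (σ : R →+* R) (H : Matrix n n R) (c : R) (p : n → R) :
    (∑ i, ∑ k, σ ((c • p) i) * H i k * (c • p) k) = c * σ c * ∑ i, ∑ k, σ (p i) * H i k * p k := by
  simp only [Pi.smul_apply, smul_eq_mul, map_mul, Finset.mul_sum]
  refine Finset.sum_congr rfl fun i _ => Finset.sum_congr rfl fun k _ => ?_
  ring

/-- The unit norm test `∃ z unit, y = z σ(z)` ignores unit factors of the form `t σ(t)`: for units `t, t′`, `t σ(t) x` passes iff `t′ σ(t′) x` does.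
[folklore] -/
private theorem exists_isUnit_eq_mul_map_iff_of_isUnit (σ : R →+* R) {t t' : R} (ht : IsUnit t) (ht' : IsUnit t') (x : R) :
    (∃ z : R, IsUnit z ∧ t * σ t * x = z * σ z) ↔ (∃ z : R, IsUnit z ∧ t' * σ t' * x = z * σ z) := by
  have aux : ∀ {s s' : R}, IsUnit s → IsUnit s' →
      (∃ z : R, IsUnit z ∧ s * σ s * x = z * σ z) → (∃ z : R, IsUnit z ∧ s' * σ s' * x = z * σ z) := by
    intro s s' hs hs' ⟨z, hz, h⟩
    obtain ⟨su, rfl⟩ := hs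
    refine ⟨z * s' * ↑su⁻¹, (hz.mul hs').mul (Units.isUnit _), ?_⟩
    have e1 : (su : R) * ↑su⁻¹ = 1 := Units.mul_inv su
    have e2 : σ (su : R) * σ ↑su⁻¹ = 1 := by rw [← map_mul, e1, map_one]
    calc s' * σ s' * x = s' * σ s' * x * (((su : R) * ↑su⁻¹) * (σ (su : R) * σ ↑su⁻¹)) := by rw [e1, e2, mul_one, mul_one]
      _ = ((su : R) * σ su * x) * (s' * σ s') * (↑su⁻¹ * σ ↑su⁻¹) := by ring
      _ = (z * σ z) * (s' * σ s') * (↑su⁻¹ * σ ↑su⁻¹) := by rw [h]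
      _ = z * s' * ↑su⁻¹ * σ (z * s' * ↑su⁻¹) := by rw [map_mul, map_mul]; ring
  exact ⟨aux ht ht', aux ht' ht⟩

end Generic

/-! ## §1 On a matching pair the `u`-eigenline of `γ′` is the line of `p`, `P_v = p qᵀ` -/

section Eigenline

variable (L : Type) [Field L] [NumberField L] [IsCMField L] (v : HeightOneSpectrum (𝓞 ↥(maximalRealSubfield L)))
  (H' : Matrix (Fin 3) (Fin 3) L)
  (a : (UnitaryGroup.cmDatum L 2 (Matrix.of fun i j : Fin 2 => if i.val + j.val + 1 = 2 then (1 : L) else 0)).Local v ×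
      (UnitaryGroup.cmDatum L 1 (Matrix.of fun i j : Fin 1 => if i.val + j.val + 1 = 1 then (1 : L) else 0)).Local v)
  (b : (UnitaryGroup.cmDatum L 3 H').Local v)

/-- **Every vector in the image of a rank-one `P_v = p qᵀ` is a multiple of `p`**: `P_v r = (q · r) p`. [cite: Rogawski1990, §3.5 Prop. 3.5.2 (c) p. 29] -/
theorem finEigenlineProjector_mulVec_of_eq_vecMulVec {p q : Fin 3 → UnitaryGroup.LocalRing L v}
    (hP : finEigenlineProjector L v H' a b = vecMulVec p q) (r : Fin 3 → UnitaryGroup.LocalRing L v) :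
    finEigenlineProjector L v H' a b *ᵥ r = (q ⬝ᵥ r) • p := by
  rw [hP, vecMulVec_mulVec]
  ext i
  rw [Pi.smul_apply, Pi.smul_apply, MulOpposite.smul_eq_mul_unop, MulOpposite.unop_op, smul_eq_mul, mul_comm]

/-- **`P_v` is the polynomial `χ_g` in `γ′`, so a `u`-eigenvector `p′` of `γ′` (`γ′ p′ = u p′`, `u = γ₂`) is an eigenvector of `P_v` with eigenvalue
`χ_g(u) = u² − tr(g) u + det(g)`** (★ `eval_finCharpolyTwo_finGammaTwo`). [cite: Rogawski1990, §4.9 p. 55] -/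
theorem finEigenlineProjector_mulVec_of_eigenvector {p' : Fin 3 → UnitaryGroup.LocalRing L v}
    (hp' : (b.val.val : Matrix (Fin 3) (Fin 3) (UnitaryGroup.LocalRing L v)) *ᵥ p' = finGammaTwo L v a • p') :
    finEigenlineProjector L v H' a b *ᵥ p' = ((finCharpolyTwo L v a).eval (finGammaTwo L v a)) • p' := by
  rw [eval_finCharpolyTwo_finGammaTwo]
  have h2 : ((b.val.val : Matrix (Fin 3) (Fin 3) (UnitaryGroup.LocalRing L v)) * b.val.val) *ᵥ p' =
      (finGammaTwo L v a * finGammaTwo L v a) • p' := by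
    rw [← mulVec_mulVec, hp', mulVec_smul, hp', smul_smul]
  dsimp only [finEigenlineProjector]
  rw [add_mulVec, sub_mulVec, h2, smul_mulVec, hp', smul_smul, smul_mulVec, one_mulVec, ← sub_smul, ← add_smul]

/-- **The `u`-eigenline is the line of `p`** (no dimension count, over the ring `E_v`): on a pair with `P_v = p qᵀ` and `χ_g(u)` a unit (`G`-regular,
★ `isUnit_eval_finCharpolyTwo_of_isLocalGRegular`), every `u`-eigenvector `p′` of `γ′` is `χ_g(u)⁻¹ (q · p′) · p`. [cite: Rogawski1990, §3.5 Prop. 3.5.2 (c) p. 29; §4.3 p. 42] -/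
theorem eigenvector_eq_smul_of_eq_vecMulVec {p q p' : Fin 3 → UnitaryGroup.LocalRing L v}
    (hP : finEigenlineProjector L v H' a b = vecMulVec p q)
    (hu : IsUnit ((finCharpolyTwo L v a).eval (finGammaTwo L v a)))
    (hp' : (b.val.val : Matrix (Fin 3) (Fin 3) (UnitaryGroup.LocalRing L v)) *ᵥ p' = finGammaTwo L v a • p') :
    p' = ((↑hu.unit⁻¹ : UnitaryGroup.LocalRing L v) * (q ⬝ᵥ p')) • p := by
  have h1 := finEigenlineProjector_mulVec_of_eigenvector L v H' a b hp'
  rw [finEigenlineProjector_mulVec_of_eq_vecMulVec L v H' a b hP] at h1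
  -- `h1 : (q ⬝ᵥ p′) • p = χ_g(u) • p′`
  have h3 : ((↑hu.unit⁻¹ : UnitaryGroup.LocalRing L v) * (finCharpolyTwo L v a).eval (finGammaTwo L v a)) = 1 := hu.val_inv_mul
  calc p' = ((↑hu.unit⁻¹ : UnitaryGroup.LocalRing L v) * (finCharpolyTwo L v a).eval (finGammaTwo L v a)) • p' := by rw [h3, one_smul]
    _ = (↑hu.unit⁻¹ : UnitaryGroup.LocalRing L v) • (((finCharpolyTwo L v a).eval (finGammaTwo L v a)) • p') := by rw [smul_smul]
    _ = (↑hu.unit⁻¹ : UnitaryGroup.LocalRing L v) • ((q ⬝ᵥ p') • p) := by rw [h1]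
    _ = ((↑hu.unit⁻¹ : UnitaryGroup.LocalRing L v) * (q ⬝ᵥ p')) • p := by rw [smul_smul]

/-- **The columns of `P_v` are `u`-eigenvectors of `γ′`** on a matching pair: `γ′ · P_v = u · P_v` — for `γ′ = c ι_v(γ_H) c⁻¹` one has
`P_v = c (χ_g(u) E₂₂) c⁻¹` (★ `finEigenlineProjector_eq_of_conj_eq`) and the middle column of the pattern `ι_v(g, u)` is `u e₂` (equivalently:
Cayley–Hamilton, `χ_{γ′} = (X − u)·χ_g`). [cite: Rogawski1990, §4.9 p. 55; §3.5 Prop. 3.5.2 (c) p. 29] -/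
theorem localMatrix_mul_finEigenlineProjector (h : IsLocalNormPair L H' v a b) :
    (b.val.val : Matrix (Fin 3) (Fin 3) (UnitaryGroup.LocalRing L v)) * finEigenlineProjector L v H' a b =
      finGammaTwo L v a • finEigenlineProjector L v H' a b := by
  rw [isLocalNormPair_iff] at h
  obtain ⟨c, hc⟩ := isConj_iff.1 h
  have hmat : (b.val.val : Matrix (Fin 3) (Fin 3) (UnitaryGroup.LocalRing L v)) =
      (c.val : Matrix (Fin 3) (Fin 3) (UnitaryGroup.LocalRing L v)) * (endoEmbLocal L v a).val.val * (c⁻¹).val := by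
    rw [← Units.val_mul, ← Units.val_mul, hc]
  have h1 : ((c⁻¹).val : Matrix (Fin 3) (Fin 3) (UnitaryGroup.LocalRing L v)) * c.val = 1 := by
    rw [← Units.val_mul, inv_mul_cancel, Units.val_one]
  set g : Matrix (Fin 2) (Fin 2) (UnitaryGroup.LocalRing L v) := a.1.val.val with hg
  set U : Matrix (Fin 1) (Fin 1) (UnitaryGroup.LocalRing L v) := a.2.val.val with hU
  have hι : ((endoEmbLocal L v a).val.val : Matrix (Fin 3) (Fin 3) (UnitaryGroup.LocalRing L v)) =
      !![g 0 0, 0, g 0 1; 0, U 0 0, 0; g 1 0, 0, g 1 1] := by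
    rw [coe_endoEmbLocal, coe_endoGL_eq]
  have hu : finGammaTwo L v a = U 0 0 := rfl
  -- the middle column of the pattern: `ι_v(g, u) e₂ = u e₂`
  have hcol : ∀ s : UnitaryGroup.LocalRing L v,
      (!![g 0 0, 0, g 0 1; 0, U 0 0, 0; g 1 0, 0, g 1 1] : Matrix (Fin 3) (Fin 3) (UnitaryGroup.LocalRing L v)) *ᵥ Pi.single 1 s =
        U 0 0 • Pi.single 1 s := by
    intro s
    ext i
    fin_cases i <;> simp [mulVec, dotProduct, Fin.sum_univ_three]
  rw [finEigenlineProjector_eq_of_conj_eq L v H' a b c hc, hmat, hu]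
  calc (c.val : Matrix (Fin 3) (Fin 3) (UnitaryGroup.LocalRing L v)) * (endoEmbLocal L v a).val.val * (c⁻¹).val *
        ((c.val : Matrix (Fin 3) (Fin 3) (UnitaryGroup.LocalRing L v)) *
          vecMulVec (Pi.single 1 ((finCharpolyTwo L v a).eval (finGammaTwo L v a))) (Pi.single 1 1) * (c⁻¹).val)
      = (c.val : Matrix (Fin 3) (Fin 3) (UnitaryGroup.LocalRing L v)) * ((endoEmbLocal L v a).val.val * (((c⁻¹).val * c.val) *
          vecMulVec (Pi.single 1 ((finCharpolyTwo L v a).eval (finGammaTwo L v a))) (Pi.single 1 1))) * (c⁻¹).val := by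
        simp only [Matrix.mul_assoc]
    _ = (c.val : Matrix (Fin 3) (Fin 3) (UnitaryGroup.LocalRing L v)) *
          (U 0 0 • vecMulVec (Pi.single 1 ((finCharpolyTwo L v a).eval (finGammaTwo L v a))) (Pi.single 1 1)) * (c⁻¹).val := by
        rw [h1, Matrix.one_mul, hι, mul_vecMulVec, hcol, ← smul_vecMulVec]
    _ = U 0 0 • ((c.val : Matrix (Fin 3) (Fin 3) (UnitaryGroup.LocalRing L v)) *
          vecMulVec (Pi.single 1 ((finCharpolyTwo L v a).eval (finGammaTwo L v a))) (Pi.single 1 1) * (c⁻¹).val) := by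
        rw [Matrix.mul_smul, Matrix.smul_mul]

/-- Hence **every column of `P_v` is a `u`-eigenvector**: `γ′ (P_v e_j) = u (P_v e_j)`. [cite: Rogawski1990, §4.9 p. 55] -/
theorem localMatrix_mulVec_finEigenlineProjector_col (h : IsLocalNormPair L H' v a b) (j : Fin 3) :
    (b.val.val : Matrix (Fin 3) (Fin 3) (UnitaryGroup.LocalRing L v)) *ᵥ (fun i => finEigenlineProjector L v H' a b i j) =
      finGammaTwo L v a • fun i => finEigenlineProjector L v H' a b i j := by
  have hM := localMatrix_mul_finEigenlineProjector L v H' a b h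
  ext i
  have hij := congrFun (congrFun hM i) j
  rw [Matrix.mul_apply] at hij
  simp only [mulVec, dotProduct, Pi.smul_apply, smul_eq_mul]
  rw [hij, Matrix.smul_apply, smul_eq_mul]

/-- A non-zero `u`-eigenvector forces `P_v ≠ 0` when `χ_g(u)` is a unit (`P_v p′ = χ_g(u) p′ ≠ 0`). [cite: Rogawski1990, §4.9 p. 55] -/
theorem finEigenlineProjector_ne_zero_of_eigenvector {p' : Fin 3 → UnitaryGroup.LocalRing L v}
    (hu : IsUnit ((finCharpolyTwo L v a).eval (finGammaTwo L v a)))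
    (hp' : (b.val.val : Matrix (Fin 3) (Fin 3) (UnitaryGroup.LocalRing L v)) *ᵥ p' = finGammaTwo L v a • p') (hne : p' ≠ 0) :
    finEigenlineProjector L v H' a b ≠ 0 := by
  intro h0
  have h1 := finEigenlineProjector_mulVec_of_eigenvector L v H' a b hp'
  rw [h0, zero_mulVec] at h1
  apply hne
  have h2 := congrArg (fun w : Fin 3 → UnitaryGroup.LocalRing L v => (↑hu.unit⁻¹ : UnitaryGroup.LocalRing L v) • w) h1
  simp only [smul_zero, smul_smul, hu.val_inv_mul, one_smul] at h2
  exact h2.symm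

end Eigenline

/-! ## §2–§3 The reading of `κ_v` on any non-zero `u`-eigenvector -/

section Reading

variable (L : Type) [Field L] [NumberField L] [IsCMField L] (v : HeightOneSpectrum (𝓞 ↥(maximalRealSubfield L)))
  (H' : Matrix (Fin 3) (Fin 3) L)
  (a : (UnitaryGroup.cmDatum L 2 (Matrix.of fun i j : Fin 2 => if i.val + j.val + 1 = 2 then (1 : L) else 0)).Local v ×
      (UnitaryGroup.cmDatum L 1 (Matrix.of fun i j : Fin 1 => if i.val + j.val + 1 = 1 then (1 : L) else 0)).Local v)
  (b : (UnitaryGroup.cmDatum L 3 H').Local v)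

open scoped Classical in
/-- **`κ_v` READS ON ANY `u`-EIGENVECTOR (non-split `v`).**  On a matching pair `ι_v(γ_H) ↔ γ′` with `χ_g(u)` a unit (e.g. `γ_H` `G`-regular), at a
place `v` with ONE place of `L` above it, for every non-zero `p′ ∈ E_v³` with `γ′ p′ = u p′`:
`κ_v(γ_H, γ′) = +1` if `x₀(p′) = Σ_{i,k} σ(p′_i)(H′_v)_{ik} p′_k` is of the form `z σ(z)` with `z` a unit of `E_v = L_w`, and `−1` otherwise — the value of
the endoscopic character on `inv(ι_v(γ_H), γ′)`, whose degree-one coordinate is the class of `H′(p′, p′)` modulo norms [§3.5 Prop. 3.5.2 (c)].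
[cite: Rogawski1990, §3.5 Prop. 3.5.2 (c) p. 29; §4.3 p. 43; §14.6 p. 242] [cite: LanglandsShelstad1987, §1] -/
theorem finKappaAt_eq_ite_of_eigenvector (hv : Subsingleton (UnitaryGroup.PlacesOver L v)) (h : IsLocalNormPair L H' v a b)
    (hu : IsUnit ((finCharpolyTwo L v a).eval (finGammaTwo L v a))) {p' : Fin 3 → UnitaryGroup.LocalRing L v}
    (hp' : (b.val.val : Matrix (Fin 3) (Fin 3) (UnitaryGroup.LocalRing L v)) *ᵥ p' = finGammaTwo L v a • p') (hne : p' ≠ 0) :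
    finKappaAt L v H' a b =
      if ∃ z : UnitaryGroup.LocalRing L v, IsUnit z ∧
          (∑ i : Fin 3, ∑ k : Fin 3, UnitaryGroup.conjLocal L (IsCMField.complexConj L) v (p' i) *
            ((UnitaryGroup.adelicForm L 3 H').map (UnitaryGroup.adeleToLocal L v)) i k * p' k) =
          z * UnitaryGroup.conjLocal L (IsCMField.complexConj L) v z
      then 1 else -1 := by
  obtain ⟨p, q, hP⟩ := finEigenlineProjector_eq_vecMulVec_of_isLocalNormPair L v H' a b h
  have hPne : finEigenlineProjector L v H' a b ≠ 0 := finEigenlineProjector_ne_zero_of_eigenvector L v H' a b hu hp' hne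
  obtain ⟨t, ht, hr⟩ := finRelPos_eq_of_eq_vecMulVec L v H' a b hv hP hPne
  -- `p′ = c • p` with `c` a unit (non-split: non-zero ⇒ unit)
  have hc := eigenvector_eq_smul_of_eq_vecMulVec L v H' a b hP hu hp'
  set c : UnitaryGroup.LocalRing L v := (↑hu.unit⁻¹ : UnitaryGroup.LocalRing L v) * (q ⬝ᵥ p') with hcdef
  have hcu : IsUnit c := by
    refine isUnit_localRing_of_ne_zero_of_subsingleton L v hv fun h0 => hne ?_
    rw [hc, h0, zero_smul]
  unfold finKappaAt
  rw [if_neg hPne, if_neg (not_not.2 hv), hr, hc, sum_sum_map_smul_mul_mul_smul,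
    exists_isUnit_eq_mul_map_iff_of_isUnit (UnitaryGroup.conjLocal L (IsCMField.complexConj L) v) ht hcu]

open scoped Classical in
/-- **`κ_v = +1` when `H′(p′, p′)` is a unit norm** (non-split `v`, any non-zero `u`-eigenvector `p′`). [cite: Rogawski1990, §14.6 p. 242; §4.3 p. 43] -/
theorem finKappaAt_eq_one_of_eigenvector_of_exists (hv : Subsingleton (UnitaryGroup.PlacesOver L v)) (h : IsLocalNormPair L H' v a b)
    (hu : IsUnit ((finCharpolyTwo L v a).eval (finGammaTwo L v a))) {p' : Fin 3 → UnitaryGroup.LocalRing L v}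
    (hp' : (b.val.val : Matrix (Fin 3) (Fin 3) (UnitaryGroup.LocalRing L v)) *ᵥ p' = finGammaTwo L v a • p') (hne : p' ≠ 0)
    (hx : ∃ z : UnitaryGroup.LocalRing L v, IsUnit z ∧
      (∑ i : Fin 3, ∑ k : Fin 3, UnitaryGroup.conjLocal L (IsCMField.complexConj L) v (p' i) *
        ((UnitaryGroup.adelicForm L 3 H').map (UnitaryGroup.adeleToLocal L v)) i k * p' k) =
        z * UnitaryGroup.conjLocal L (IsCMField.complexConj L) v z) :
    finKappaAt L v H' a b = 1 := by
  rw [finKappaAt_eq_ite_of_eigenvector L v H' a b hv h hu hp' hne, if_pos hx]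

open scoped Classical in
/-- **`κ_v = −1` when `H′(p′, p′)` is not a unit norm** (non-split `v`, any non-zero `u`-eigenvector `p′`). [cite: Rogawski1990, §14.6 p. 242; §4.3 p. 43] -/
theorem finKappaAt_eq_neg_one_of_eigenvector_of_not_exists (hv : Subsingleton (UnitaryGroup.PlacesOver L v)) (h : IsLocalNormPair L H' v a b)
    (hu : IsUnit ((finCharpolyTwo L v a).eval (finGammaTwo L v a))) {p' : Fin 3 → UnitaryGroup.LocalRing L v}
    (hp' : (b.val.val : Matrix (Fin 3) (Fin 3) (UnitaryGroup.LocalRing L v)) *ᵥ p' = finGammaTwo L v a • p') (hne : p' ≠ 0)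
    (hx : ¬ ∃ z : UnitaryGroup.LocalRing L v, IsUnit z ∧
      (∑ i : Fin 3, ∑ k : Fin 3, UnitaryGroup.conjLocal L (IsCMField.complexConj L) v (p' i) *
        ((UnitaryGroup.adelicForm L 3 H').map (UnitaryGroup.adeleToLocal L v)) i k * p' k) =
        z * UnitaryGroup.conjLocal L (IsCMField.complexConj L) v z) :
    finKappaAt L v H' a b = -1 := by
  rw [finKappaAt_eq_ite_of_eigenvector L v H' a b hv h hu hp' hne, if_neg hx]

open scoped Classical in
/-- **At a split `v` the sign is `+1`** on the same hypotheses (a non-zero `u`-eigenvector with `χ_g(u)` a unit forces `P_v ≠ 0`; then ★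
`finKappaAt_of_not_subsingleton`). [cite: Rogawski1990, §14.6 p. 242] -/
theorem finKappaAt_eq_one_of_eigenvector_of_not_subsingleton (hv : ¬ Subsingleton (UnitaryGroup.PlacesOver L v))
    (hu : IsUnit ((finCharpolyTwo L v a).eval (finGammaTwo L v a))) {p' : Fin 3 → UnitaryGroup.LocalRing L v}
    (hp' : (b.val.val : Matrix (Fin 3) (Fin 3) (UnitaryGroup.LocalRing L v)) *ᵥ p' = finGammaTwo L v a • p') (hne : p' ≠ 0) :
    finKappaAt L v H' a b = 1 :=
  finKappaAt_of_not_subsingleton L v H' a (finEigenlineProjector_ne_zero_of_eigenvector L v H' a b hu hp' hne) hv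

end Reading

end Literature.NumberTheory.Rogawski1990

end
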